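import Literature.NumberTheory.LFunctions.SmoothedExplicitFormulaContour
import HarnessLib

/-!
# Kadiri's test function `f(t) = η h(ηt)` with the kernel of Mossinghoff–Trudgian–Yang §9 as an admissible smoothing

Topic `Literature/NumberTheory/LFunctions`. Everything here is PROVED; one definition
(`Literature.NumberTheory.LFunctions.kadiriTest`), no named fact. In Kadiri's method (Acta Arith.
117 (2005), §2.2; Mossinghoff–Trudgian 2015 §2; Mossinghoff–Trudgian–Yang 2024 §9 with the kernel
`h = h^{(1)}_{1,θ}` of (9.2)) the explicit formula is applied to the test function
`f(t) = η h_θ(ηt)` on `[0, d₁(θ)/η]`, `0` beyond, where `η = 1 − β₀` for the zero `β₀ + iγ₀`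
under examination. This file realises `f` as a function on `ℝ`,

  `kadiriTest θ η t = η · w_θ(η · max(t, 0))`,  `w_θ = g ∗ g` (`fordW`, `= h^{(1)}_{1,θ}` on `[0, 2θ cot θ]`),

continuous on `ℝ` (the values on `(−∞, 0)` are irrelevant: only `f(log n)`, `n ≥ 1`, and
`∫_0^∞ f e^{−zt}` are ever used), and proves that it is an admissible smoothing for the tree's
smoothed explicit formula (`IsSmoothedEFTest`, `SmoothedExplicitFormulaContour.lean`) with the `C²`
profile `p = mtyH1 η θ` (`= η h^{(1)}_{1,θ}(η·)`, `mtyH1_eq_mul_mtyH1_one`), `x₀ = d₁(θ)/η`: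
(H₁) `p(x₀) = p'(x₀) = 0` are the tree's `mtyH1_d1`, `mtyH1Deriv_d1`. Also: `f ≥ 0`,
`f(0) = η w_θ(0) = η g₁(θ)` (`g₁ = fordSmoothW0`), the Laplace transform is the interval integral
of the tree's scaled lemmas (`kadiri_f_laplace_eq_scaled`, `kadiri_lemma32_scaled`,
`kadiri_f_laplace_re_nonneg`), so that Kadiri's Lemma 3.2 and (H₂) transfer to `fordLaplace f`.

## References

* H. Kadiri, Acta Arith. 117 (2005) = arXiv:math/0401238, §2.2 (the test function `f`, (H₁),
  (H₂), Lemma 3.2). (`Kadiri2005`)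
* M. J. Mossinghoff, T. S. Trudgian, A. Yang, Res. Number Theory 10 (2024) = arXiv:2212.06867,
  §9, (9.2). (`MossinghoffTrudgianYangRNT2024`)
-/

noncomputable section

open Complex Real MeasureTheory Set

namespace Literature.NumberTheory.LFunctions

/-- **Kadiri's test function** `f(t) = η h_θ(ηt)` on `[0, d₁(θ)/η]`, `0` on `[d₁(θ)/η, ∞)`, with
the kernel `h_θ = h^{(1)}_{1,θ} = w_θ` of Mossinghoff–Trudgian–Yang (9.2), extended continuously
to `ℝ` by `f(t) = η w_θ(η max(t,0))`. [cite: Kadiri2005, §2.2] -/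
def kadiriTest (θ η : ℝ) (t : ℝ) : ℝ :=
  η * fordW θ (η * max t 0)

namespace KadiriTest

variable {θ η : ℝ}

/-- `d₁(θ) = 2θ cot θ > 0`. [folklore] -/
theorem mtyD1_pos (hθ : 0 < θ) (hθ' : θ < π / 2) : 0 < mtyD1 θ := by
  unfold mtyD1
  have := theta_mul_cot_pos hθ hθ'
  nlinarith

/-- On `[0, d₁/η]` the test function is `η h(ηt) = mtyH1 η θ t`. [folklore] -/
theorem eq_mtyH1 (hθ : 0 < θ) (hθ' : θ < π / 2) (hη : 0 < η) {t : ℝ} (ht0 : 0 ≤ t)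
    (ht : t ≤ mtyD1 θ / η) : kadiriTest θ η t = mtyH1 η θ t := by
  unfold kadiriTest
  rw [max_eq_left ht0, mtyH1_eq_mul_mtyH1_one η θ t hη.ne',
    fordW_eq_mtyH1 hθ hθ' (by positivity) ?_]
  have h := mul_le_mul_of_nonneg_left ht hη.le
  rw [mul_div_cancel₀ _ hη.ne'] at h
  unfold mtyD1 at h
  linarith

/-- On `[d₁/η, ∞)` the test function vanishes. [folklore] -/
theorem eq_zero (hθ : 0 < θ) (hθ' : θ < π / 2) (hη : 0 < η) {t : ℝ} (ht : mtyD1 θ / η ≤ t) :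
    kadiriTest θ η t = 0 := by
  have hD := mtyD1_pos hθ hθ'
  have ht0 : 0 ≤ t := le_trans (by positivity) ht
  rcases ht.eq_or_lt with h | h
  · rw [← h, eq_mtyH1 hθ hθ' hη (by positivity) le_rfl, mtyH1_d1 hη.ne' hθ hθ']
  · unfold kadiriTest
    rw [max_eq_left ht0, fordW_eq_zero_of_lt, mul_zero]
    have h2 := mul_lt_mul_of_pos_left h hη
    rw [mul_div_cancel₀ _ hη.ne'] at h2
    unfold mtyD1 at h2
    linarith

/-- The test function is continuous on `ℝ`. [folklore] -/
theorem continuous (hθ : 0 < θ) (hθ' : θ < π / 2) : Continuous (kadiriTest θ η) := by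
  unfold kadiriTest
  rw [fordW_eq_fordKernelW]
  exact continuous_const.mul ((continuous_fordKernelW hθ hθ').comp (by fun_prop))

/-- The test function is non-negative. [folklore] -/
theorem nonneg (hθ : 0 < θ) (hθ' : θ < π / 2) (hη : 0 < η) (t : ℝ) : 0 ≤ kadiriTest θ η t :=
  mul_nonneg hη.le (fordW_nonneg hθ hθ' _)

/-- `f(0) = η g₁(θ)` with `g₁(θ) = h_θ(0) = w_θ(0) = fordSmoothW0 θ`. [cite: Kadiri2005, §2.2] -/
theorem map_zero (hθ : 0 < θ) (hθ' : θ < π / 2) : kadiriTest θ η 0 = η * fordSmoothW0 θ := by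
  unfold kadiriTest
  rw [max_self, mul_zero, fordW_zero hθ hθ']

/-- **`f` is an admissible smoothing** for the smoothed explicit formula, with profile
`p = mtyH1 η θ`, `p' = mtyH1Deriv η θ`, `p'' = mtyH1Deriv2 η θ`, `x₀ = d₁(θ)/η`
((H₁): `h(d₁) = h'(d₁) = 0`). [cite: Kadiri2005, §2.2 (H₁)] -/
theorem isSmoothedEFTest (hθ : 0 < θ) (hθ' : θ < π / 2) (hη : 0 < η) :
    IsSmoothedEFTest (kadiriTest θ η) (mtyH1 η θ) (mtyH1Deriv η θ) (mtyH1Deriv2 η θ) (mtyD1 θ / η) where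
  cont := continuous hθ hθ'
  x₀_nonneg := by have := mtyD1_pos hθ hθ'; positivity
  eqOn := fun t ht ↦ eq_mtyH1 hθ hθ' hη ht.1 ht.2
  eq_zero := fun u hu ↦ eq_zero hθ hθ' hη hu
  hasDerivAt := hasDerivAt_mtyH1 hη.ne' (by
    rw [Real.tan_eq_sin_div_cos]
    exact (div_pos (Real.sin_pos_of_pos_of_lt_pi hθ (by linarith [Real.pi_pos]))
      (Real.cos_pos_of_mem_Ioo ⟨by linarith, hθ'⟩)).ne')
  hasDerivAt' := hasDerivAt_mtyH1Deriv η θ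
  cont'' := continuous_mtyH1Deriv2 η θ
  p_x₀ := mtyH1_d1 hη.ne' hθ hθ'
  p'_x₀ := mtyH1Deriv_d1 hη.ne' hθ hθ'

/-- **The Laplace transform of the test function** is the interval integral of the tree's scaled
lemmas: `F(z) = ∫₀^{d₁/η} η h(ηt) e^{−zt} dt`. [cite: Kadiri2005, §2.2 (2.4)] -/
theorem fordLaplace_eq (hθ : 0 < θ) (hθ' : θ < π / 2) (hη : 0 < η) (z : ℂ) :
    fordLaplace (kadiriTest θ η) z =
      ∫ t in (0 : ℝ)..(mtyD1 θ / η), (η * mtyH1 1 θ (η * t) : ℂ) * Complex.exp (-(z * t)) := by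
  have hD := mtyD1_pos hθ hθ'
  rw [fordLaplace_eq_intervalIntegral (p := mtyH1 η θ) (by positivity)
    (fun t ht ↦ eq_mtyH1 hθ hθ' hη ht.1 ht.2) (fun u hu ↦ eq_zero hθ hθ' hη hu) (continuous_mtyH1 η θ)]
  refine intervalIntegral.integral_congr fun t _ ↦ ?_
  simp only [mtyH1_eq_mul_mtyH1_one η θ t hη.ne']
  push_cast
  ring

/-- **(H₂) for the test function**: `Re F(X + iY) ≥ 0` for `X ≥ 0` (the tree's
`mtyH1_laplace_re_nonneg'`, Kadiri's (H₂) = Heath-Brown's Lemma 7.1, transported along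
`F_f(z) = F_h(z/η)`). [cite: Kadiri2005, §2.2 (H₂)] -/
theorem re_fordLaplace_nonneg (hθ : 0 < θ) (hθ' : θ < π / 2) (hη : 0 < η) {X : ℝ} (hX : 0 ≤ X) (Y : ℝ) :
    0 ≤ (fordLaplace (kadiriTest θ η) ((X : ℂ) + Y * I)).re := by
  rw [fordLaplace_eq hθ hθ' hη, kadiri_f_laplace_eq_scaled hη]
  have h := mtyH1_laplace_re_nonneg' hθ hθ' (X := X / η) (by positivity) (Y / η)
  have e : ((X / η : ℝ) : ℂ) + ((Y / η : ℝ) : ℂ) * Complex.I = ((X : ℂ) + Y * I) / η := by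
    push_cast
    field_simp
  rw [e] at h
  exact h

/-- **Kadiri's Lemma 3.2 for the test function**: for `z ≠ 0`,
`|Re F(z) − η g₁(θ) Re z/‖z‖²| ≤ M(Re z/η) η²/‖z‖²`, `M(x) = ∫₀^{d₁}|h''(u)|e^{−xu}du` (`mtyM`).
[cite: Kadiri2005, Lemma 3.2] -/
theorem abs_re_fordLaplace_sub_le (hθ : 0 < θ) (hθ' : θ < π / 2) (hη : 0 < η) {z : ℂ} (hz : z ≠ 0) :
    |(fordLaplace (kadiriTest θ η) z).re - η * fordSmoothW0 θ * z.re / ‖z‖ ^ 2| ≤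
      mtyM θ (z.re / η) * η ^ 2 / ‖z‖ ^ 2 := by
  rw [fordLaplace_eq hθ hθ' hη]
  exact kadiri_lemma32_scaled hθ hθ' hη hz

/-- `M(x) ≤ M(x')` for `x' ≤ x` (`mtyM` is antitone: `e^{−xu} ≤ e^{−x'u}` on `u ≥ 0`). [folklore] -/
theorem mtyM_antitone (hθ : 0 < θ) (hθ' : θ < π / 2) : Antitone (mtyM θ) := by
  intro x y hxy
  have hD := mtyD1_pos hθ hθ'
  unfold mtyM
  refine intervalIntegral.integral_mono_on hD.le ?_ ?_ fun u hu ↦ ?_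
  · exact ((continuous_abs.comp (continuous_mtyH1Deriv2 1 θ)).mul (by fun_prop)).intervalIntegrable _ _
  · exact ((continuous_abs.comp (continuous_mtyH1Deriv2 1 θ)).mul (by fun_prop)).intervalIntegrable _ _
  · refine mul_le_mul_of_nonneg_left (Real.exp_le_exp.2 ?_) (abs_nonneg _)
    nlinarith [hu.1]

/-- `M(x) ≥ 0`. [folklore] -/
theorem mtyM_nonneg (hθ : 0 < θ) (hθ' : θ < π / 2) (x : ℝ) : 0 ≤ mtyM θ x := by
  have hD := mtyD1_pos hθ hθ'
  unfold mtyM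
  exact intervalIntegral.integral_nonneg hD.le fun u _ ↦ mul_nonneg (abs_nonneg _) (Real.exp_nonneg _)

end KadiriTest

end Literature.NumberTheory.LFunctions
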